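import Mathlib
import HarnessLib

/-!
# Markman 2025 — the descent-exponent arithmetic of [M] §9.3 / [S] §11.3, AS PRINTED and kernel-checked

E. Markman: [M] *Cycles on abelian 2n-folds of Weil type from secant sheaves on abelian n-folds*,
arXiv:2502.03415 **v2** (2025-06-08), bib `Markman2025SecantWeil` — UNREFEREED PREPRINT; [S] *Secant sheaves and
Weil classes on abelian varieties*, arXiv:2509.23403 **v2** (2026-02-11; v1 = v2 on the lines quoted), bib
`Markman2025SurveySecant` — the survey (published carrier ICM 2026 Proc., bib `Markman2026ICMSecant`; the results it
reports remain PREPRINT). Pages/lines below are PyMuPDF lines of the public arXiv PDFs (v2 of [M]: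
sha256/16 `8155aa33870069b8`; v2 of [S]: `3151aee3307548da`), read at seat lit-w-markman (pub-hsemireg, 2026-08-23).

WHAT IS PRINTED (verbatim). In the construction of the one semiregular object of [M] (the `Ḡ`-equivariant reflexive
secant^{⊠2}-sheaf on `X × X̂`, `X` the Jacobian of a generic genus-3 curve, and its DESCENT to the quotient abelian
sixfold), the linearization of `G ⊗ det(G)^a` rests on an elementary congruence:

* [M] v2 p. 84 L18–20: «The rank `r` of `E` is `8d`. If `d` is even, then `gcd(r, n) = gcd(8d, d + 1) = 1` and there
  exists a positive integer `a`, such that `ar ≡ −1` modulo `n`. Set `D := det(G)`.» — followed by LEMMA 9.3.5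
  (p. 84 L21) «If `d` is even,²⁵ then the object `G ⊗ Dᵃ` admits a `Ḡ`-linearization.», footnote 25 (p. 84
  L63–68) «Note that `ℚ(√−d) = ℚ(√−4d)`, so the assumption that `d` is even does not restrict the compex [sic]
  multiplications we can treat.»; here `n = d + 1` is the exponent of `G` (p. 84 L10–11 «The group `G` has
  exponent `n = d + 1`.»).
* [M] v2 p. 83 L53–57, LEMMA 9.3.4 and proof: «If `d` is even, then the divisibility `div(det(G))` is relatively
  prime to the order `(d + 1)²` of `G`. Proof. … The order `(d + 1)²` of `Ĝ` is relatively prime to the rank `8d`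
  of `G` …»; p. 84 L7–8 «Regardless of the parity of `d`, the intersection `Ḡ ∩ ker(φ_{det(G)})` consists of the
  elements of `Ḡ` of order dividing `gcd(d + 1, 8)`, by proof of the above lemma.»
* [S] v2 p. 19 L31–33 (= v1): «Let `D := det(G)` be the determinant line bundle of `G`. Let `a` be a positive
  integer, such that `8qa ≡ −1 (mod. q + 1)`. Such an integer `a` exists, by our assumption that `q` is even.»
  (rank `8q`, [S] Prop. 11.1 (2) p. 18 L48), with [S] p. 18 L5–7 «… which forces `K = ℚ(√−q)` to be a quadratic
  imaginary number field. We may choose `q` to be a positive integer. We may also choose `q` to be even and `≥ 4`,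
  since `ℚ(√−q) = ℚ(√−4q)`.»

WHAT THIS FILE PROVES (theorems only; NO named fact, nothing geometric): the arithmetic content of those sentences —
`gcd(8d, d+1) = gcd(8, d+1)` for every `d` (the p. 84 L7–8 shadow); `8d` and `d + 1` (hence `8d` and `(d+1)²`)
are coprime IFF `d` is even; for `d` even a POSITIVE `a` with `a·8d ≡ −1 (mod d+1)` exists ([M] form) and a
positive `a` with `8qa ≡ −1 (mod q+1)` exists for `q` even ([S] form); for `d` ODD no integer `a` at all satisfies
the congruence, so existence holds IFF `d` is even (the parity hypothesis of Lemma 9.3.5 / Lemma 11.2 is exactly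
what the arithmetic needs — the converse direction is a seat remark, not a sentence of [M]/[S]); the footnote-25
repair `d ↦ 4d` always lands in the even case; and the field identity
`ℚ(√−d) = ℚ(√−4d)` in the form `ℚ⟮2x⟯ = ℚ⟮x⟯` inside any field of characteristic zero. HONEST FRAMING: bookkeeping
of a printed elementary step, for seats that re-derive Markman's descent (M-Mk6 of the pub-hsemireg LIT-W table);
it says nothing about sheaves, semiregularity, or the Hodge conjecture, and re-proves no theorem of [M]/[S].

Deliberately NOT here: the groups `G, Ḡ, Ĝ`, `det(G)`, linearizations ([M] Lemma 9.3.5 itself), Orlov's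
equivalence — none has a carrier in the tree; the equivariant-semiregularity vocabulary is
`HodgeTheory/InvolutionEquivariantSemiregularity`.
-/

namespace Literature.AlgebraicGeometry.Markman2025

/-! ### The gcd shadow of [M] p. 84 L7–8 and Lemma 9.3.4 -/

/-- `d` and `d + 1` are coprime (consecutive integers); private helper. [folklore] -/
private theorem coprime_self_succ (d : ℕ) : Nat.Coprime d (d + 1) :=
  Nat.coprime_self_add_right.mpr (Nat.coprime_one_right d)

/-- **[M] v2 p. 84 L7–8, arithmetic shadow**: `gcd(8d, d + 1) = gcd(8, d + 1)` for every `d` — the factor `d` of the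
rank `8d` is invisible modulo the exponent `n = d + 1`, so only `gcd(d + 1, 8)` survives («the elements of `Ḡ` of
order dividing `gcd(d + 1, 8)`»). [cite: Markman2025SecantWeil, §9.3, v2 p. 84 L7–8 (arithmetic content only)] -/
theorem gcd_eight_mul_succ (d : ℕ) : Nat.gcd (8 * d) (d + 1) = Nat.gcd 8 (d + 1) :=
  Nat.Coprime.gcd_mul_right_cancel 8 (coprime_self_succ d)

/-- `8` and `d + 1` are coprime iff `d` is even (`8 = 2³`; `d + 1` odd iff `d` even); private helper. [folklore] -/
private theorem coprime_eight_succ_iff (d : ℕ) : Nat.Coprime 8 (d + 1) ↔ Even d := by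
  have h8 : (8 : ℕ) = 2 ^ 3 := by norm_num
  rw [h8, Nat.coprime_pow_left_iff (by norm_num : 0 < 3), Nat.coprime_two_left, Nat.odd_add_one,
    Nat.not_odd_iff_even]

/-- **[M] v2 p. 84 L18–19 «If `d` is even, then `gcd(r, n) = gcd(8d, d + 1) = 1`», with its converse**: the rank
`8d` and the exponent `d + 1` are coprime IFF `d` is even.
[cite: Markman2025SecantWeil, §9.3, v2 p. 84 L18–19 (arithmetic content; the «iff» direction is folklore)] -/
theorem coprime_eight_mul_succ_iff (d : ℕ) : Nat.Coprime (8 * d) (d + 1) ↔ Even d := by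
  rw [Nat.Coprime, gcd_eight_mul_succ, ← Nat.Coprime, coprime_eight_succ_iff]

/-- The printed direction: `d` even ⟹ `gcd(8d, d + 1) = 1`.
[cite: Markman2025SecantWeil, §9.3, v2 p. 84 L18–19] -/
theorem coprime_eight_mul_succ_of_even {d : ℕ} (hd : Even d) : Nat.Coprime (8 * d) (d + 1) :=
  (coprime_eight_mul_succ_iff d).mpr hd

/-- **[M] Lemma 9.3.4, proof, v2 p. 83 L56 «The order `(d + 1)²` of `Ĝ` is relatively prime to the rank `8d` of
`G`»** (for `d` even, the standing hypothesis of Lemma 9.3.4): arithmetic content.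
[cite: Markman2025SecantWeil, Lemma 9.3.4 (proof), v2 p. 83 L53–57] -/
theorem coprime_eight_mul_succ_sq_of_even {d : ℕ} (hd : Even d) : Nat.Coprime (8 * d) ((d + 1) ^ 2) :=
  (coprime_eight_mul_succ_of_even hd).pow_right 2

/-! ### Existence of the positive exponent `a` -/

/-- For coprime `r, n` with `n > 0` there is a POSITIVE integer `a` with `a·r ≡ −1 (mod n)`. (For `n = 0` the
congruence is an equality in `ℤ` and fails; for `n = 1` every `a` works.) Private helper. [folklore] -/
private theorem exists_pos_mul_modEq_neg_one_of_coprime {r n : ℕ} (h : Nat.Coprime r n) (hn : 0 < n) :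
    ∃ a : ℕ, 0 < a ∧ ((a : ℤ) * r) ≡ -1 [ZMOD n] := by
  rcases Nat.lt_or_ge 1 n with hn1 | hn1
  · obtain ⟨m, -, hm⟩ := Nat.exists_mul_mod_eq_one_of_coprime h hn1
    have hm0 : m ≠ 0 := by
      rintro rfl
      simp at hm
    refine ⟨m * (n - 1), Nat.mul_pos (Nat.pos_of_ne_zero hm0) (by omega), ?_⟩
    -- `r * m = n * t + 1` in `ℕ`, hence `m (n-1) r = (n t + 1)(n - 1) ≡ -1 (mod n)`.
    obtain ⟨t, ht⟩ : ∃ t : ℕ, r * m = n * t + 1 :=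
      ⟨r * m / n, by have := Nat.div_add_mod (r * m) n; omega⟩
    have hn1' : ((m * (n - 1) : ℕ) : ℤ) = (m : ℤ) * ((n : ℤ) - 1) := by
      rw [Nat.cast_mul, Nat.cast_sub (by omega)]; simp
    have hcast : ((r : ℤ) * m) = (n : ℤ) * (t : ℤ) + 1 := by exact_mod_cast ht
    rw [Int.modEq_iff_dvd, hn1']
    exact ⟨-(t : ℤ) * ((n : ℤ) - 1) - 1, by linear_combination (-((n : ℤ)) + 1) * hcast⟩
  · -- `n = 1`: everything is congruent modulo `1`.
    have hn' : n = 1 := by omega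
    subst hn'
    exact ⟨1, Nat.one_pos, Int.modEq_one⟩

/-- **[M] v2 p. 84 L18–20 «If `d` is even, then `gcd(r, n) = gcd(8d, d + 1) = 1` and there exists a positive
integer `a`, such that `ar ≡ −1` modulo `n`»** (`r = 8d`, `n = d + 1`) — the arithmetic sentence preceding
Lemma 9.3.5, proved. [cite: Markman2025SecantWeil, §9.3, v2 p. 84 L18–20] -/
theorem exists_descentExponent_of_even {d : ℕ} (hd : Even d) :
    ∃ a : ℕ, 0 < a ∧ ((a : ℤ) * (8 * d : ℕ)) ≡ -1 [ZMOD (d + 1 : ℕ)] :=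
  exists_pos_mul_modEq_neg_one_of_coprime (coprime_eight_mul_succ_of_even hd) (Nat.succ_pos d)

/-- **[S] v2 p. 19 L31–33 «Let `a` be a positive integer, such that `8qa ≡ −1 (mod. q + 1)`. Such an integer `a`
exists, by our assumption that `q` is even.»** — proved (the survey's form; rank `8q` by [S] Prop. 11.1 (2)).
[cite: Markman2025SurveySecant, §11.3, v2 p. 19 L31–33 (= v1); Prop. 11.1 (2), p. 18] -/
theorem exists_descentExponent_survey_of_even {q : ℕ} (hq : Even q) :
    ∃ a : ℕ, 0 < a ∧ (8 * q * a : ℤ) ≡ -1 [ZMOD (q + 1 : ℕ)] := by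
  obtain ⟨a, ha, h⟩ := exists_descentExponent_of_even hq
  refine ⟨a, ha, ?_⟩
  have : (8 * q * a : ℤ) = (a : ℤ) * (8 * q : ℕ) := by push_cast; ring
  rwa [this]

/-- If `d` is ODD then NO integer `a` (positive or not) satisfies `a·8d ≡ −1 (mod d + 1)` — `a·8d` is even while
`d + 1` is even and `−1` is odd; private helper for the «iff» below. [folklore] -/
private theorem not_exists_descentExponent_of_odd {d : ℕ} (hd : Odd d) :
    ¬ ∃ a : ℤ, (a * (8 * d : ℕ)) ≡ -1 [ZMOD (d + 1 : ℕ)] := by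
  rintro ⟨a, ha⟩
  obtain ⟨k, rfl⟩ := hd
  -- modulo 2: `d + 1 = 2(k+1)` divides `a * 8 d + 1`, while `a * 8 d` is even.
  have h2 : (2 : ℤ) ∣ ((2 * k + 1 + 1 : ℕ) : ℤ) := ⟨(k : ℤ) + 1, by push_cast; ring⟩
  have hd2 : ((2 * k + 1 + 1 : ℕ) : ℤ) ∣ a * ((8 * (2 * k + 1) : ℕ) : ℤ) - (-1) :=
    Int.modEq_iff_dvd.mp ha.symm
  have h1 : (2 : ℤ) ∣ a * ((8 * (2 * k + 1) : ℕ) : ℤ) - (-1) := dvd_trans h2 hd2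
  have h0 : (2 : ℤ) ∣ a * ((8 * (2 * k + 1) : ℕ) : ℤ) :=
    ⟨a * (4 * (2 * k + 1)), by push_cast; ring⟩
  have h3 : (2 : ℤ) ∣ (a * ((8 * (2 * k + 1) : ℕ) : ℤ) - (-1)) - a * ((8 * (2 * k + 1) : ℕ) : ℤ) :=
    dvd_sub h1 h0
  have h4 : (a * ((8 * (2 * k + 1) : ℕ) : ℤ) - (-1)) - a * ((8 * (2 * k + 1) : ℕ) : ℤ) = 1 := by ring
  rw [h4] at h3
  exact absurd (Int.eq_one_of_dvd_one (by norm_num) h3) (by norm_num)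

/-- **The printed parity hypothesis is exactly right** ([M] v2 p. 84 L18–21: «If `d` is even, then … there exists a
positive integer `a`, such that `ar ≡ −1` modulo `n`» + Lemma 9.3.5 «If `d` is even,²⁵ …»; [S] v2 p. 19 L32–33
«Such an integer `a` exists, by our assumption that `q` is even»): an integer `a` with `a·8d ≡ −1 (mod d + 1)`
exists IF AND ONLY IF `d` is even (printed direction ⇐, with `a > 0`, = `exists_descentExponent_of_even`; the
converse ⇒ is a parity check — for `d` odd, `d + 1` is even and `a·8d + 1` is odd). The printed remedy for odd `d`
is footnote 25 (`d ↦ 4d`, same field), next.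
[cite: Markman2025SecantWeil, §9.3, v2 p. 84 L18–21 and footnote 25 (the hypothesis «d is even»; converse direction folklore)] -/
theorem exists_descentExponent_iff_even (d : ℕ) :
    (∃ a : ℤ, (a * (8 * d : ℕ)) ≡ -1 [ZMOD (d + 1 : ℕ)]) ↔ Even d := by
  refine ⟨fun h ↦ ?_, fun hd ↦ ?_⟩
  · by_contra hodd
    exact not_exists_descentExponent_of_odd (Nat.not_even_iff_odd.mp hodd) h
  · obtain ⟨a, -, ha⟩ := exists_descentExponent_of_even hd
    exact ⟨a, ha⟩

/-- **Footnote 25 of [M] (v2 p. 84 L63–68) / [S] p. 18 L5–7, arithmetic half**: replacing `d` by `4d` (the same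
field `ℚ(√−d) = ℚ(√−4d)`) always lands in the even case, so the positive exponent exists for `8·(4d)` modulo
`4d + 1` with NO parity hypothesis on `d`. [cite: Markman2025SecantWeil, §9.3 footnote 25, v2 p. 84 L63–68] -/
theorem exists_descentExponent_four_mul (d : ℕ) :
    ∃ a : ℕ, 0 < a ∧ ((a : ℤ) * (8 * (4 * d) : ℕ)) ≡ -1 [ZMOD (4 * d + 1 : ℕ)] :=
  exists_descentExponent_of_even ⟨2 * d, by ring⟩

/-- **Footnote 25 of [M] / [S] p. 18 L7, field half: `ℚ(√−d) = ℚ(√−4d)`** in the form actually used — for any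
element `x` of a field `F` of characteristic zero (e.g. `x = √−d ∈ ℂ`, `2x = √−4d`), adjoining `2x` to `ℚ` gives the
same intermediate field as adjoining `x`. [cite: Markman2025SecantWeil, §9.3 footnote 25, v2 p. 84 L63–68]
[cite: Markman2025SurveySecant, §11, v2 p. 18 L5–7] -/
theorem adjoin_two_mul_eq {F : Type*} [Field F] [CharZero F] [Algebra ℚ F] (x : F) :
    IntermediateField.adjoin ℚ {(2 : F) * x} = IntermediateField.adjoin ℚ {x} := by
  apply le_antisymm
  · rw [IntermediateField.adjoin_simple_le_iff]
    exact mul_mem (by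
      have : (2 : F) = algebraMap ℚ F 2 := by simp
      rw [this]; exact IntermediateField.algebraMap_mem _ 2) (IntermediateField.mem_adjoin_simple_self ℚ x)
  · rw [IntermediateField.adjoin_simple_le_iff]
    have key : (algebraMap ℚ F (1 / 2 : ℚ)) * ((2 : F) * x) = x := by
      rw [map_div₀, map_one, map_ofNat]
      field_simp
    have hmem : (algebraMap ℚ F (1 / 2 : ℚ)) * ((2 : F) * x) ∈ IntermediateField.adjoin ℚ {(2 : F) * x} :=
      mul_mem (IntermediateField.algebraMap_mem _ _) (IntermediateField.mem_adjoin_simple_self ℚ _)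
    rw [key] at hmem
    exact hmem

/-- In `ℂ`: `√(4d) = 2√d` (for every real `d`; both sides vanish when `d < 0` by Mathlib's convention
`Real.sqrt` of a negative number `= 0`), so `i√(4d) = 2(i√d)` — the concrete instance of the previous lemma's `2x`
(`x = i√d`); private helper. [folklore] -/
private theorem I_mul_sqrt_four_mul (d : ℝ) :
    Complex.I * (Real.sqrt (4 * d) : ℂ) = 2 * (Complex.I * (Real.sqrt d : ℂ)) := by
  have h4 : Real.sqrt (4 * d) = 2 * Real.sqrt d := by
    rw [Real.sqrt_mul (by norm_num : (0:ℝ) ≤ 4), show Real.sqrt 4 = 2 by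
      rw [show (4:ℝ) = 2 ^ 2 by norm_num, Real.sqrt_sq (by norm_num : (0:ℝ) ≤ 2)]]
  rw [h4]; push_cast; ring

/-- The two halves of footnote 25 together, in `ℂ`: `ℚ(i√(4d)) = ℚ(i√d)` as subfields of `ℂ`, for every real `d`
(meaningful for `d > 0`, where `i√d = √−d`). [cite: Markman2025SecantWeil, §9.3 footnote 25, v2 p. 84 L63–68] -/
theorem adjoin_I_mul_sqrt_four_mul (d : ℝ) :
    IntermediateField.adjoin ℚ {Complex.I * (Real.sqrt (4 * d) : ℂ)} =
      IntermediateField.adjoin ℚ {Complex.I * (Real.sqrt d : ℂ)} := by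
  rw [I_mul_sqrt_four_mul d, adjoin_two_mul_eq]

/-! ### Numerals (sanity instances; `example`s carry no tag)

`q = 4` is the survey's smallest admissible `q` ([S] v2 p. 18 L7 «even and `≥ 4`»): rank `32`, exponent `5`,
`a = 2` works (`8·4·2 = 64 = 13·5 − 1`). `d = 2`: rank `16`, exponent `3`, `a = 2` (`32 = 11·3 − 1`). `d = 6`:
rank `48`, exponent `7`, `a = 1` (`48 = 7·7 − 1`). `d = 3` is ODD: no exponent exists; the footnote-25 remedy is
`d = 12` (`ℚ(√−3) = ℚ(√−12)`): rank `96`, exponent `13`, `a = 5` (`480 = 37·13 − 1`). -/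

/-- **[S] v2 p. 18 L5–7 «We may also choose `q` to be even and `≥ 4`»** — at the smallest such `q = 4` the
exponent `a = 2` satisfies `8qa = 64 ≡ −1 (mod q + 1 = 5)`. [cite: Markman2025SurveySecant, §11, v2 p. 18 L5–7] -/
theorem descentExponent_survey_four : (8 * 4 * 2 : ℤ) ≡ -1 [ZMOD (4 + 1 : ℕ)] := by decide

example : ((2 : ℤ) * (8 * 2 : ℕ)) ≡ -1 [ZMOD (2 + 1 : ℕ)] := by decide
example : ((1 : ℤ) * (8 * 6 : ℕ)) ≡ -1 [ZMOD (6 + 1 : ℕ)] := by decide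
example : ((5 : ℤ) * (8 * 12 : ℕ)) ≡ -1 [ZMOD (12 + 1 : ℕ)] := by decide
example : ¬ ∃ a : ℤ, (a * (8 * 3 : ℕ)) ≡ -1 [ZMOD (3 + 1 : ℕ)] :=
  fun h ↦ (by decide : ¬ Even 3) ((exists_descentExponent_iff_even 3).mp h)
example : Nat.gcd (8 * 3) (3 + 1) = 4 := by decide

end Literature.AlgebraicGeometry.Markman2025
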